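import Summits.NavierStokesRegularity.NavierStokesRegularity.Theorems.EfficiencyFloorRigidExitResonance
import Literature.Analysis.FluidPDE.CurlIsometryCovariance
import Literature.Analysis.FluidPDE.FlatSwirlGauge
import HarnessLib

/-!
# Route `EfficiencyFloor`, support `RigidExit` (stmt-25513) on the `ProductionEfficiencyDecay` ladder (stmt-22866):
# `E·Z` is a symmetry invariant — clause (a) feeds the resonance alternative BY NAME

Helper file (`--supports stmt-NavierStokesRegularity-22866 --as helper`), sequel to `…RigidExitResonance`. There the early
orbit-selection step of `RigidExit` is replaced by: «`E·Z = (∫|m|²)(∫|curl m|²)` takes finitely many values on the normalised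
maximisers, none equal to `256ν⁴/(27c⋆⁴)`» ⟹ a non-maximiser instant in every interval ⟹ the early-deficit inequality at every
slice time with some margin. This file supplies the link to the route's clause (a):

* `integral_norm_sq_orbitSlice`, `integral_curl_sq_orbitSlice`, `energy_enstrophy_orbitSlice`: under the full symmetry group
  (translation `a`, linear isometry `R`, scaling `l > 0`), `E ↦ l⁻¹E`, `Z ↦ l·Z`, so `E·Z` is ORBIT INVARIANT (pseudovector
  covariance of the curl, tree `norm_curl_conj_linearIsometryEquiv`; dilation `curl_smul_comp_smul`; Haar scaling of Lebesgue measure).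
* `finite_values_of_classification`: the classification half of clause (a) ⟹ `E·Z` takes finitely many values on the maximiser set.
* `earlyDeficit_everywhere_of_maximiserSetRigidity_nonresonant` (BY NAME): `Theses.EfficiencyFloor.MaximiserSetRigidity` + «no
  normalised maximiser is resonant» ⟹ for the sharp constant and every `0 < η < 1`, along every solution of the route's class, at
  EVERY slice time `s ∈ (0,T)` with `s + ηW(s) < T`: `(1 − η + 2θ)·Z(u s)⁻² ≤ Z(u(s + ηW(s)))⁻²` for some `θ > 0`.

So, granted (a), the «instant exit» half of `RigidExit` holds at all times off ONE codimension-one scalar condition on the finitely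
many maximiser orbits (`E·Z ≠ 256ν⁴/(27c⋆⁴)`); what remains is the uniformity of `θ` (continuous dependence) and the resonant
orbits. HONEST FRAMING: statements about a HYPOTHETICAL blow-up; `RigidExit`, clause (a), `NearMaximiserBoundedAmplification`,
`LerayFloorGap`, `ProductionEfficiencyDecay` (stmt-22866) and Navier–Stokes regularity stay OPEN; no summit statement is proved.
[folklore]
-/

-- the problem directory repeats the summit name (`NavierStokesRegularity/NavierStokesRegularity`)
set_option linter.dupNamespace false

noncomputable section

open Set Filter MeasureTheory Topology Function
open scoped InnerProductSpace RealInnerProductSpace ENNReal NNReal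
open Literature.Analysis.FluidPDE

namespace Summit.NavierStokesRegularity.NavierStokesRegularity.Theorems

namespace RigidExit

namespace Resonance

open NearMaximiserBoundedAmplification MaximiserSetRigidity.ProfileLiouville

/-! ## `E·Z` is a symmetry invariant -/

/-- Curl of a translate: `curl (g(· − a))(x) = (curl g)(x − a)` (no differentiability hypothesis). [folklore] -/
theorem curl_comp_sub_const (g : EuclideanSpace ℝ (Fin 3) → EuclideanSpace ℝ (Fin 3)) (a x : EuclideanSpace ℝ (Fin 3)) :
    curl (fun y => g (y - a)) x = curl g (x - a) := by
  have h := curl_comp_add_const g (-a) x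
  simp only [← sub_eq_add_neg] at h
  exact h

/-- **Energy of an orbit slice**: `∫|l•R(m(l•R⁻¹(x − a)))|² dx = l⁻¹ ∫|m|²` (`l > 0`, `R` a linear isometry). [folklore] -/
theorem integral_norm_sq_orbitSlice (m : EuclideanSpace ℝ (Fin 3) → EuclideanSpace ℝ (Fin 3)) (a : EuclideanSpace ℝ (Fin 3))
    (R : EuclideanSpace ℝ (Fin 3) ≃ₗᵢ[ℝ] EuclideanSpace ℝ (Fin 3)) {l : ℝ} (hl : 0 < l) :
    ∫ x, ‖l • R (m (l • R.symm (x - a)))‖ ^ 2 = l⁻¹ * ∫ x, ‖m x‖ ^ 2 := by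
  have hpt : ∀ x, ‖l • R (m (l • R.symm (x - a)))‖ ^ 2 = l ^ 2 * (fun y => ‖m (l • R.symm y)‖ ^ 2) (x - a) := by
    intro x
    simp only [norm_smul, LinearIsometryEquiv.norm_map, Real.norm_eq_abs, abs_of_pos hl, mul_pow]
  simp_rw [hpt]
  rw [integral_const_mul, integral_sub_right_eq_self (fun y => ‖m (l • R.symm y)‖ ^ 2) a]
  have hR : ∫ y, ‖m (l • R.symm y)‖ ^ 2 = ∫ z, ‖m (l • z)‖ ^ 2 :=
    R.symm.measurePreserving.integral_comp R.symm.toHomeomorph.measurableEmbedding (fun z => ‖m (l • z)‖ ^ 2)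
  rw [hR, Measure.integral_comp_smul volume (fun z => ‖m z‖ ^ 2) l, finrank_euclideanSpace_fin,
    abs_of_pos (inv_pos.2 (pow_pos hl 3)), smul_eq_mul]
  field_simp

/-- **Enstrophy of an orbit slice**: `∫|curl(l•R(m(l•R⁻¹(· − a))))|² = l · ∫|curl m|²` (`l > 0`, `R` a linear isometry; the
vorticity is a pseudovector, its norm is isometry invariant). [folklore] -/
theorem integral_curl_sq_orbitSlice (m : EuclideanSpace ℝ (Fin 3) → EuclideanSpace ℝ (Fin 3)) (a : EuclideanSpace ℝ (Fin 3))
    (R : EuclideanSpace ℝ (Fin 3) ≃ₗᵢ[ℝ] EuclideanSpace ℝ (Fin 3)) {l : ℝ} (hl : 0 < l) :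
    ∫ x, ‖curl (fun x => l • R (m (l • R.symm (x - a)))) x‖ ^ 2 = l * ∫ x, ‖curl m x‖ ^ 2 := by
  -- the slice is the translate by `a` of `g = R ∘ v ∘ R⁻¹` with `v = l • m(l • ·)`
  set v : EuclideanSpace ℝ (Fin 3) → EuclideanSpace ℝ (Fin 3) := fun z => l • m (l • z) with hv
  set g : EuclideanSpace ℝ (Fin 3) → EuclideanSpace ℝ (Fin 3) := fun y => R (v (R.symm y)) with hg
  have hug : (fun x => l • R (m (l • R.symm (x - a)))) = fun x => g (x - a) := by
    funext x
    simp only [hg, hv, LinearIsometryEquiv.map_smul]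
  rw [hug]
  have h1 : ∀ x, ‖curl (fun y => g (y - a)) x‖ ^ 2 = (fun y => ‖curl g y‖ ^ 2) (x - a) := fun x => by
    rw [curl_comp_sub_const]
  simp_rw [h1]
  rw [integral_sub_right_eq_self (fun y => ‖curl g y‖ ^ 2) a]
  have h2 : ∀ y, ‖curl g y‖ ^ 2 = (fun z => ‖curl v z‖ ^ 2) (R.symm y) := fun y => by
    simp only [hg, norm_curl_conj_linearIsometryEquiv R v y]
  simp_rw [h2]
  rw [R.symm.measurePreserving.integral_comp R.symm.toHomeomorph.measurableEmbedding (fun z => ‖curl v z‖ ^ 2)]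
  have h3 : ∀ z, ‖curl v z‖ ^ 2 = l ^ 4 * (fun w => ‖curl m w‖ ^ 2) (l • z) := fun z => by
    simp only [hv, curl_smul_comp_smul m l l z, norm_smul, Real.norm_eq_abs, abs_mul, abs_of_pos hl, mul_pow]
    ring
  simp_rw [h3]
  rw [integral_const_mul, Measure.integral_comp_smul volume (fun w => ‖curl m w‖ ^ 2) l, finrank_euclideanSpace_fin,
    abs_of_pos (inv_pos.2 (pow_pos hl 3)), smul_eq_mul]
  field_simp

/-- **`E·Z` is constant on symmetry orbits**: `E(l•R(m(l•R⁻¹(· − a))))·Z(…) = E(m)·Z(m)`. [folklore] -/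
theorem energy_enstrophy_orbitSlice (m : EuclideanSpace ℝ (Fin 3) → EuclideanSpace ℝ (Fin 3)) (a : EuclideanSpace ℝ (Fin 3))
    (R : EuclideanSpace ℝ (Fin 3) ≃ₗᵢ[ℝ] EuclideanSpace ℝ (Fin 3)) {l : ℝ} (hl : 0 < l) :
    (∫ x, ‖l • R (m (l • R.symm (x - a)))‖ ^ 2) * (∫ x, ‖curl (fun x => l • R (m (l • R.symm (x - a)))) x‖ ^ 2) =
      (∫ x, ‖m x‖ ^ 2) * (∫ x, ‖curl m x‖ ^ 2) := by
  rw [integral_norm_sq_orbitSlice m a R hl, integral_curl_sq_orbitSlice m a R hl]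
  field_simp

/-- **Clause (a)'s classification ⟹ `E·Z` takes finitely many values on the normalised maximisers** (the hypothesis of §3–§5):
the values are those of the finitely many representatives `ms i`. [folklore] -/
theorem finite_values_of_classification {c ν : ℝ}
    (hA : ∃ (k : ℕ) (ms : Fin k → EuclideanSpace ℝ (Fin 3) → EuclideanSpace ℝ (Fin 3)),
      ∀ m : EuclideanSpace ℝ (Fin 3) → EuclideanSpace ℝ (Fin 3), ((ContDiff ℝ (⊤ : ℕ∞) m ∧ VectorCalculus.IsDivFree m ∧
        (∫⁻ x, ‖iteratedFDeriv ℝ 0 m x‖ₑ ^ 2 < ⊤) ∧ (∫⁻ x, ‖iteratedFDeriv ℝ 1 m x‖ₑ ^ 2 < ⊤) ∧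
        (∫⁻ x, ‖iteratedFDeriv ℝ 2 m x‖ₑ ^ 2 < ⊤)) ∧ 0 < (∫ x, ‖curl m x‖ ^ 2) ∧
        (∫ x, ⟪curl m x, fderiv ℝ m x (curl m x)⟫_ℝ) = c * (∫ x, ‖curl m x‖ ^ 2) ^ (3 / 4 : ℝ) *
          (∫ x, frobeniusNormSq (fderiv ℝ (curl m) x)) ^ (3 / 4 : ℝ) ∧
        (∫ x, frobeniusNormSq (fderiv ℝ (curl m) x)) = 81 * c ^ 4 / (256 * ν ^ 4) * (∫ x, ‖curl m x‖ ^ 2) ^ 3) →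
        ∃ (i : Fin k) (a : EuclideanSpace ℝ (Fin 3)) (R : EuclideanSpace ℝ (Fin 3) ≃ₗᵢ[ℝ] EuclideanSpace ℝ (Fin 3)) (l : ℝ),
          0 < l ∧ m = fun x => l • R (ms i (l • R.symm (x - a)))) :
    ∃ S : Finset ℝ, ∀ m : EuclideanSpace ℝ (Fin 3) → EuclideanSpace ℝ (Fin 3), ((ContDiff ℝ (⊤ : ℕ∞) m ∧ VectorCalculus.IsDivFree m ∧
        (∫⁻ x, ‖iteratedFDeriv ℝ 0 m x‖ₑ ^ 2 < ⊤) ∧ (∫⁻ x, ‖iteratedFDeriv ℝ 1 m x‖ₑ ^ 2 < ⊤) ∧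
        (∫⁻ x, ‖iteratedFDeriv ℝ 2 m x‖ₑ ^ 2 < ⊤)) ∧ 0 < (∫ x, ‖curl m x‖ ^ 2) ∧
        (∫ x, ⟪curl m x, fderiv ℝ m x (curl m x)⟫_ℝ) = c * (∫ x, ‖curl m x‖ ^ 2) ^ (3 / 4 : ℝ) *
          (∫ x, frobeniusNormSq (fderiv ℝ (curl m) x)) ^ (3 / 4 : ℝ) ∧
        (∫ x, frobeniusNormSq (fderiv ℝ (curl m) x)) = 81 * c ^ 4 / (256 * ν ^ 4) * (∫ x, ‖curl m x‖ ^ 2) ^ 3) →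
        (∫ x, ‖m x‖ ^ 2) * (∫ x, ‖curl m x‖ ^ 2) ∈ S := by
  classical
  obtain ⟨k, ms, hclass⟩ := hA
  refine ⟨Finset.univ.image fun i => (∫ x, ‖ms i x‖ ^ 2) * (∫ x, ‖curl (ms i) x‖ ^ 2), fun m hNM => ?_⟩
  obtain ⟨i, a, R, l, hl, heq⟩ := hclass m hNM
  rw [Finset.mem_image]
  refine ⟨i, Finset.mem_univ i, ?_⟩
  rw [heq, energy_enstrophy_orbitSlice (ms i) a R hl]


/-! ## BY NAME: clause (a) of the route decl + non-resonance ⟹ early deficit at every slice time -/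

/-- **Early deficit everywhere from `MaximiserSetRigidity` and non-resonance.** For the sharp constant `c⋆` and every
`0 < η < 1`: granted the route decl `MaximiserSetRigidity` (its clause (a) classifies the normalised maximisers by finitely many
orbits) and that NO normalised maximiser (for `c⋆` and the solution's `ν`) is resonant, `(∫|m|²)(∫|curl m|²) ≠ 256ν⁴/(27c⋆⁴)`,
along every maximal classical Leray–Hopf rapidly-decaying-datum solution the early-deficit inequality holds at EVERY slice time
`s ∈ (0,T)` with `s + ηW(s) < T`, with some margin `θ = θ(u,s) > 0`. [folklore] -/
theorem earlyDeficit_everywhere_of_maximiserSetRigidity_nonresonant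
    (hM : Summit.NavierStokesRegularity.NavierStokesRegularity.Theses.EfficiencyFloor.MaximiserSetRigidity) :
    ∃ c : ℝ, (0 < c ∧ (∀ v : EuclideanSpace ℝ (Fin 3) → EuclideanSpace ℝ (Fin 3), (ContDiff ℝ (⊤ : ℕ∞) v ∧
      VectorCalculus.IsDivFree v ∧ (∫⁻ x, ‖iteratedFDeriv ℝ 0 v x‖ₑ ^ 2 < ⊤) ∧ (∫⁻ x, ‖iteratedFDeriv ℝ 1 v x‖ₑ ^ 2 < ⊤) ∧
      (∫⁻ x, ‖iteratedFDeriv ℝ 2 v x‖ₑ ^ 2 < ⊤)) → (∫ x, ⟪curl v x, fderiv ℝ v x (curl v x)⟫_ℝ) ≤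
      c * (∫ x, ‖curl v x‖ ^ 2) ^ (3 / 4 : ℝ) * (∫ x, frobeniusNormSq (fderiv ℝ (curl v) x)) ^ (3 / 4 : ℝ)) ∧
      ∀ c' : ℝ, (∀ w : EuclideanSpace ℝ (Fin 3) → EuclideanSpace ℝ (Fin 3), (ContDiff ℝ (⊤ : ℕ∞) w ∧
      VectorCalculus.IsDivFree w ∧ (∫⁻ x, ‖iteratedFDeriv ℝ 0 w x‖ₑ ^ 2 < ⊤) ∧ (∫⁻ x, ‖iteratedFDeriv ℝ 1 w x‖ₑ ^ 2 < ⊤) ∧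
      (∫⁻ x, ‖iteratedFDeriv ℝ 2 w x‖ₑ ^ 2 < ⊤)) → (∫ x, ⟪curl w x, fderiv ℝ w x (curl w x)⟫_ℝ) ≤
      c' * (∫ x, ‖curl w x‖ ^ 2) ^ (3 / 4 : ℝ) * (∫ x, frobeniusNormSq (fderiv ℝ (curl w) x)) ^ (3 / 4 : ℝ)) → c ≤ c') ∧
      ∀ η : ℝ, 0 < η → η < 1 → ∀ (ν T : ℝ), 0 < ν → 0 < T →
      ∀ (u : ℝ → EuclideanSpace ℝ (Fin 3) → EuclideanSpace ℝ (Fin 3)) (p : ℝ → EuclideanSpace ℝ (Fin 3) → ℝ),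
      IsMaximalSmoothSolution ν 0 u p T → IsLerayHopfOn T ν 0 (u 0) u → HasRapidSpatialDecay (u 0) →
      (∀ m : EuclideanSpace ℝ (Fin 3) → EuclideanSpace ℝ (Fin 3), ((ContDiff ℝ (⊤ : ℕ∞) m ∧ VectorCalculus.IsDivFree m ∧
        (∫⁻ x, ‖iteratedFDeriv ℝ 0 m x‖ₑ ^ 2 < ⊤) ∧ (∫⁻ x, ‖iteratedFDeriv ℝ 1 m x‖ₑ ^ 2 < ⊤) ∧
        (∫⁻ x, ‖iteratedFDeriv ℝ 2 m x‖ₑ ^ 2 < ⊤)) ∧ 0 < (∫ x, ‖curl m x‖ ^ 2) ∧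
        (∫ x, ⟪curl m x, fderiv ℝ m x (curl m x)⟫_ℝ) = c * (∫ x, ‖curl m x‖ ^ 2) ^ (3 / 4 : ℝ) *
          (∫ x, frobeniusNormSq (fderiv ℝ (curl m) x)) ^ (3 / 4 : ℝ) ∧
        (∫ x, frobeniusNormSq (fderiv ℝ (curl m) x)) = 81 * c ^ 4 / (256 * ν ^ 4) * (∫ x, ‖curl m x‖ ^ 2) ^ 3) →
        (∫ x, ‖m x‖ ^ 2) * (∫ x, ‖curl m x‖ ^ 2) ≠ 256 * ν ^ 4 / (27 * c ^ 4)) →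
      ∀ s ∈ Ioo 0 T, s + η * (64 * ν ^ 3 / (27 * c ^ 4) * (∫ x, ‖curl (u s) x‖ ^ 2)⁻¹ ^ 2) < T →
        ∃ θ : ℝ, 0 < θ ∧ (1 - η + 2 * θ) * (∫ x, ‖curl (u s) x‖ ^ 2)⁻¹ ^ 2 ≤
          (∫ x, ‖curl (u (s + η * (64 * ν ^ 3 / (27 * c ^ 4) * (∫ x, ‖curl (u s) x‖ ^ 2)⁻¹ ^ 2))) x‖ ^ 2)⁻¹ ^ 2 := by
  classical
  obtain ⟨c, hsharp, h⟩ := earlyDeficit_everywhere_of_nonresonant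
  refine ⟨c, hsharp, fun η hη0 hη1 ν T hν hT u p hmax hLH hdec hNR s hs hs'T => ?_⟩
  obtain ⟨k, ms, hms, hclass⟩ := partA_of_maximiserSetRigidity hM c ν hsharp hν
  -- the finitely many values of `E·Z`, none resonant
  set S : Finset ℝ := Finset.univ.image fun i => (∫ x, ‖ms i x‖ ^ 2) * (∫ x, ‖curl (ms i) x‖ ^ 2) with hSdef
  have hS : ∀ m : EuclideanSpace ℝ (Fin 3) → EuclideanSpace ℝ (Fin 3), ((ContDiff ℝ (⊤ : ℕ∞) m ∧ VectorCalculus.IsDivFree m ∧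
        (∫⁻ x, ‖iteratedFDeriv ℝ 0 m x‖ₑ ^ 2 < ⊤) ∧ (∫⁻ x, ‖iteratedFDeriv ℝ 1 m x‖ₑ ^ 2 < ⊤) ∧
        (∫⁻ x, ‖iteratedFDeriv ℝ 2 m x‖ₑ ^ 2 < ⊤)) ∧ 0 < (∫ x, ‖curl m x‖ ^ 2) ∧
        (∫ x, ⟪curl m x, fderiv ℝ m x (curl m x)⟫_ℝ) = c * (∫ x, ‖curl m x‖ ^ 2) ^ (3 / 4 : ℝ) *
          (∫ x, frobeniusNormSq (fderiv ℝ (curl m) x)) ^ (3 / 4 : ℝ) ∧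
        (∫ x, frobeniusNormSq (fderiv ℝ (curl m) x)) = 81 * c ^ 4 / (256 * ν ^ 4) * (∫ x, ‖curl m x‖ ^ 2) ^ 3) →
      (∫ x, ‖m x‖ ^ 2) * (∫ x, ‖curl m x‖ ^ 2) ∈ S := by
    intro m hNM
    obtain ⟨i, a, R, l, hl, heq⟩ := hclass m hNM
    rw [hSdef, Finset.mem_image]
    refine ⟨i, Finset.mem_univ i, ?_⟩
    rw [heq, energy_enstrophy_orbitSlice (ms i) a R hl]
  have hR : 256 * ν ^ 4 / (27 * c ^ 4) ∉ S := by
    intro hmem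
    rw [hSdef, Finset.mem_image] at hmem
    obtain ⟨i, -, hi⟩ := hmem
    exact hNR (ms i) (hms i) hi
  exact h η hη0 hη1 ν T hν hT u p hmax hLH hdec S hS hR s hs hs'T


/-! ## Beyond finiteness: a value set of `E·Z` with EMPTY INTERIOR suffices (continuum of orbits allowed) -/

/-- **Non-maximiser instants from a thin value set.** For the sharp constant `c⋆`: suppose the set of values of
`E·Z = (∫|m|²)(∫|curl m|²)` on the normalised maximisers has EMPTY INTERIOR (every interval `(a,b)` contains a non-value — true for
finitely or countably many orbits, and for any continuum of orbits along which `E·Z` does not fill an interval) and omits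
`256ν⁴/(27c⋆⁴)`. Then along every maximal classical Leray–Hopf rapidly-decaying-datum solution EVERY interval `[s,s₁] ⊂ (0,T)`
contains an instant whose slice is NOT a normalised maximiser: on a maximiser interval `σ ↦ E(σ)Z(σ)` is continuous, affine in the
strictly increasing `Z(σ)/Z(s)` with slope `E(s)Z(s) − 256ν⁴/(27c⋆⁴) ≠ 0`, hence fills an interval (intermediate value theorem).
[folklore] -/
theorem exists_nonMaximiser_instant_of_thin_valueSet :
    ∃ c : ℝ, (0 < c ∧ (∀ v : EuclideanSpace ℝ (Fin 3) → EuclideanSpace ℝ (Fin 3), (ContDiff ℝ (⊤ : ℕ∞) v ∧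
      VectorCalculus.IsDivFree v ∧ (∫⁻ x, ‖iteratedFDeriv ℝ 0 v x‖ₑ ^ 2 < ⊤) ∧ (∫⁻ x, ‖iteratedFDeriv ℝ 1 v x‖ₑ ^ 2 < ⊤) ∧
      (∫⁻ x, ‖iteratedFDeriv ℝ 2 v x‖ₑ ^ 2 < ⊤)) → (∫ x, ⟪curl v x, fderiv ℝ v x (curl v x)⟫_ℝ) ≤
      c * (∫ x, ‖curl v x‖ ^ 2) ^ (3 / 4 : ℝ) * (∫ x, frobeniusNormSq (fderiv ℝ (curl v) x)) ^ (3 / 4 : ℝ)) ∧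
      ∀ c' : ℝ, (∀ w : EuclideanSpace ℝ (Fin 3) → EuclideanSpace ℝ (Fin 3), (ContDiff ℝ (⊤ : ℕ∞) w ∧
      VectorCalculus.IsDivFree w ∧ (∫⁻ x, ‖iteratedFDeriv ℝ 0 w x‖ₑ ^ 2 < ⊤) ∧ (∫⁻ x, ‖iteratedFDeriv ℝ 1 w x‖ₑ ^ 2 < ⊤) ∧
      (∫⁻ x, ‖iteratedFDeriv ℝ 2 w x‖ₑ ^ 2 < ⊤)) → (∫ x, ⟪curl w x, fderiv ℝ w x (curl w x)⟫_ℝ) ≤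
      c' * (∫ x, ‖curl w x‖ ^ 2) ^ (3 / 4 : ℝ) * (∫ x, frobeniusNormSq (fderiv ℝ (curl w) x)) ^ (3 / 4 : ℝ)) → c ≤ c') ∧
      ∀ (ν T : ℝ), 0 < ν → 0 < T →
      ∀ (u : ℝ → EuclideanSpace ℝ (Fin 3) → EuclideanSpace ℝ (Fin 3)) (p : ℝ → EuclideanSpace ℝ (Fin 3) → ℝ),
      IsMaximalSmoothSolution ν 0 u p T → IsLerayHopfOn T ν 0 (u 0) u → HasRapidSpatialDecay (u 0) →
      (∀ a b : ℝ, a < b → ∃ y ∈ Ioo a b, ∀ m : EuclideanSpace ℝ (Fin 3) → EuclideanSpace ℝ (Fin 3), ((ContDiff ℝ (⊤ : ℕ∞) m ∧ VectorCalculus.IsDivFree m ∧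
        (∫⁻ x, ‖iteratedFDeriv ℝ 0 m x‖ₑ ^ 2 < ⊤) ∧ (∫⁻ x, ‖iteratedFDeriv ℝ 1 m x‖ₑ ^ 2 < ⊤) ∧
        (∫⁻ x, ‖iteratedFDeriv ℝ 2 m x‖ₑ ^ 2 < ⊤)) ∧ 0 < (∫ x, ‖curl m x‖ ^ 2) ∧
        (∫ x, ⟪curl m x, fderiv ℝ m x (curl m x)⟫_ℝ) = c * (∫ x, ‖curl m x‖ ^ 2) ^ (3 / 4 : ℝ) *
          (∫ x, frobeniusNormSq (fderiv ℝ (curl m) x)) ^ (3 / 4 : ℝ) ∧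
        (∫ x, frobeniusNormSq (fderiv ℝ (curl m) x)) = 81 * c ^ 4 / (256 * ν ^ 4) * (∫ x, ‖curl m x‖ ^ 2) ^ 3) →
        (∫ x, ‖m x‖ ^ 2) * (∫ x, ‖curl m x‖ ^ 2) ≠ y) →
      (∀ m : EuclideanSpace ℝ (Fin 3) → EuclideanSpace ℝ (Fin 3), ((ContDiff ℝ (⊤ : ℕ∞) m ∧ VectorCalculus.IsDivFree m ∧
        (∫⁻ x, ‖iteratedFDeriv ℝ 0 m x‖ₑ ^ 2 < ⊤) ∧ (∫⁻ x, ‖iteratedFDeriv ℝ 1 m x‖ₑ ^ 2 < ⊤) ∧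
        (∫⁻ x, ‖iteratedFDeriv ℝ 2 m x‖ₑ ^ 2 < ⊤)) ∧ 0 < (∫ x, ‖curl m x‖ ^ 2) ∧
        (∫ x, ⟪curl m x, fderiv ℝ m x (curl m x)⟫_ℝ) = c * (∫ x, ‖curl m x‖ ^ 2) ^ (3 / 4 : ℝ) *
          (∫ x, frobeniusNormSq (fderiv ℝ (curl m) x)) ^ (3 / 4 : ℝ) ∧
        (∫ x, frobeniusNormSq (fderiv ℝ (curl m) x)) = 81 * c ^ 4 / (256 * ν ^ 4) * (∫ x, ‖curl m x‖ ^ 2) ^ 3) →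
        (∫ x, ‖m x‖ ^ 2) * (∫ x, ‖curl m x‖ ^ 2) ≠ 256 * ν ^ 4 / (27 * c ^ 4)) →
      ∀ s s₁ : ℝ, 0 < s → s < s₁ → s₁ < T → ∃ σ ∈ Icc s s₁, ¬ ((ContDiff ℝ (⊤ : ℕ∞) (u σ) ∧ VectorCalculus.IsDivFree (u σ) ∧
        (∫⁻ x, ‖iteratedFDeriv ℝ 0 (u σ) x‖ₑ ^ 2 < ⊤) ∧ (∫⁻ x, ‖iteratedFDeriv ℝ 1 (u σ) x‖ₑ ^ 2 < ⊤) ∧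
        (∫⁻ x, ‖iteratedFDeriv ℝ 2 (u σ) x‖ₑ ^ 2 < ⊤)) ∧ 0 < (∫ x, ‖curl (u σ) x‖ ^ 2) ∧
        (∫ x, ⟪curl (u σ) x, fderiv ℝ (u σ) x (curl (u σ) x)⟫_ℝ) = c * (∫ x, ‖curl (u σ) x‖ ^ 2) ^ (3 / 4 : ℝ) *
          (∫ x, frobeniusNormSq (fderiv ℝ (curl (u σ)) x)) ^ (3 / 4 : ℝ) ∧
        (∫ x, frobeniusNormSq (fderiv ℝ (curl (u σ)) x)) = 81 * c ^ 4 / (256 * ν ^ 4) * (∫ x, ‖curl (u σ) x‖ ^ 2) ^ 3) := by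
  obtain ⟨c, hsharp, haff⟩ := energy_enstrophy_affine
  obtain ⟨c₁, hsharp₁, hbud⟩ := exists_budget_saturated_iff_normalisedMaximiser
  have hc₁ : c₁ = c := sharp_const_unique hsharp₁ hsharp
  subst hc₁
  refine ⟨c₁, hsharp₁, fun ν T hν hT u p hmax hLH hdec hV hNR s s₁ hs0 hss₁ hs₁T => ?_⟩
  by_contra hall
  push Not at hall
  set R : ℝ := 256 * ν ^ 4 / (27 * c₁ ^ 4) with hRdef
  set κ : ℝ := (∫ x, ‖u s x‖ ^ 2) * (∫ x, ‖curl (u s) x‖ ^ 2) with hκ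
  have hκR : κ ≠ R := hNR (u s) (hall s ⟨le_rfl, hss₁.le⟩)
  -- the budget gives a continuous `Z = Zr` on `[s,s₁]`
  obtain ⟨Zr, D, hZD, -⟩ := hbud ν T hν hT u p hmax hLH hdec
  have hIoo : ∀ τ ∈ Icc s s₁, τ ∈ Ioo 0 T := fun τ hτ => ⟨hs0.trans_le hτ.1, hτ.2.trans_lt hs₁T⟩
  have hZeq : ∀ τ ∈ Icc s s₁, Zr τ = ∫ x, ‖curl (u τ) x‖ ^ 2 := fun τ hτ => (hZD τ (hIoo τ hτ)).2.2.2.1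
  have hZcont : ContinuousOn Zr (Icc s s₁) := fun τ hτ =>
    ((hZD τ (hIoo τ hτ)).2.2.2.2.1).continuousAt.continuousWithinAt
  -- `f = (κ − R)·(Zr/Zr s) + R` is continuous on `[s,s₁]` and equals `E·Z` there
  set f : ℝ → ℝ := fun σ => (κ - R) * (Zr σ / Zr s) + R with hf
  have hfcont : ContinuousOn f (Icc s s₁) :=
    (continuousOn_const.mul (hZcont.div_const _)).add continuousOn_const
  have hA := haff ν T hν hT u p hmax hLH hdec s s₁ hs0 hss₁ hs₁T hall
  have hfeq : ∀ σ ∈ Icc s s₁, (∫ x, ‖u σ x‖ ^ 2) * (∫ x, ‖curl (u σ) x‖ ^ 2) = f σ := fun σ hσ => by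
    simp only [hf]
    rw [(hA σ hσ).2, hZeq σ hσ, hZeq s ⟨le_rfl, hss₁.le⟩]
  -- the endpoints differ: `f s = κ`, `f s₁ = (κ − R)ρ + R` with `ρ > 1`
  have hZs : 0 < Zr s := by rw [hZeq s ⟨le_rfl, hss₁.le⟩]; exact (hall s ⟨le_rfl, hss₁.le⟩).2.1
  have hρ : 1 < Zr s₁ / Zr s := by
    rw [one_lt_div hZs, hZeq s ⟨le_rfl, hss₁.le⟩, hZeq s₁ ⟨hss₁.le, le_rfl⟩]
    exact (hA s₁ ⟨hss₁.le, le_rfl⟩).1 hss₁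
  have hne : f s ≠ f s₁ := by
    intro h
    simp only [hf] at h
    rw [div_self hZs.ne'] at h
    have h1 : (κ - R) * (Zr s₁ / Zr s - 1) = 0 := by linarith
    rcases mul_eq_zero.1 h1 with h2 | h2
    · exact hκR (sub_eq_zero.1 h2)
    · linarith
  -- an omitted value strictly between the endpoints is attained: contradiction
  rcases lt_or_gt_of_ne hne with hlt | hgt
  · obtain ⟨y, hy, hyV⟩ := hV (f s) (f s₁) hlt
    obtain ⟨σ, hσ, hσy⟩ := intermediate_value_Icc hss₁.le hfcont (Ioo_subset_Icc_self hy)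
    exact hyV (u σ) (hall σ hσ) (by rw [hfeq σ hσ, hσy])
  · obtain ⟨y, hy, hyV⟩ := hV (f s₁) (f s) hgt
    obtain ⟨σ, hσ, hσy⟩ := intermediate_value_Icc' hss₁.le hfcont (Ioo_subset_Icc_self hy)
    exact hyV (u σ) (hall σ hσ) (by rw [hfeq σ hσ, hσy])

/-- **Early deficit everywhere from a thin value set (for one solution, some margin).** For the sharp constant `c⋆` and every
`0 < η < 1`: under the hypotheses of `exists_nonMaximiser_instant_of_thin_valueSet` (value set of `E·Z` on the maximisers with empty
interior, omitting `256ν⁴/(27c⋆⁴)`), along every solution of the route's class the early-deficit inequality holds at EVERY slice time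
`s ∈ (0,T)` with `s + ηW(s) < T`, with some `θ = θ(u,s) > 0` (`RigidExit.earlyDeficit_pos_of_nonMaximiser_instant`). [folklore] -/
theorem earlyDeficit_everywhere_of_thin_valueSet :
    ∃ c : ℝ, (0 < c ∧ (∀ v : EuclideanSpace ℝ (Fin 3) → EuclideanSpace ℝ (Fin 3), (ContDiff ℝ (⊤ : ℕ∞) v ∧
      VectorCalculus.IsDivFree v ∧ (∫⁻ x, ‖iteratedFDeriv ℝ 0 v x‖ₑ ^ 2 < ⊤) ∧ (∫⁻ x, ‖iteratedFDeriv ℝ 1 v x‖ₑ ^ 2 < ⊤) ∧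
      (∫⁻ x, ‖iteratedFDeriv ℝ 2 v x‖ₑ ^ 2 < ⊤)) → (∫ x, ⟪curl v x, fderiv ℝ v x (curl v x)⟫_ℝ) ≤
      c * (∫ x, ‖curl v x‖ ^ 2) ^ (3 / 4 : ℝ) * (∫ x, frobeniusNormSq (fderiv ℝ (curl v) x)) ^ (3 / 4 : ℝ)) ∧
      ∀ c' : ℝ, (∀ w : EuclideanSpace ℝ (Fin 3) → EuclideanSpace ℝ (Fin 3), (ContDiff ℝ (⊤ : ℕ∞) w ∧
      VectorCalculus.IsDivFree w ∧ (∫⁻ x, ‖iteratedFDeriv ℝ 0 w x‖ₑ ^ 2 < ⊤) ∧ (∫⁻ x, ‖iteratedFDeriv ℝ 1 w x‖ₑ ^ 2 < ⊤) ∧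
      (∫⁻ x, ‖iteratedFDeriv ℝ 2 w x‖ₑ ^ 2 < ⊤)) → (∫ x, ⟪curl w x, fderiv ℝ w x (curl w x)⟫_ℝ) ≤
      c' * (∫ x, ‖curl w x‖ ^ 2) ^ (3 / 4 : ℝ) * (∫ x, frobeniusNormSq (fderiv ℝ (curl w) x)) ^ (3 / 4 : ℝ)) → c ≤ c') ∧
      ∀ η : ℝ, 0 < η → η < 1 → ∀ (ν T : ℝ), 0 < ν → 0 < T →
      ∀ (u : ℝ → EuclideanSpace ℝ (Fin 3) → EuclideanSpace ℝ (Fin 3)) (p : ℝ → EuclideanSpace ℝ (Fin 3) → ℝ),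
      IsMaximalSmoothSolution ν 0 u p T → IsLerayHopfOn T ν 0 (u 0) u → HasRapidSpatialDecay (u 0) →
      (∀ a b : ℝ, a < b → ∃ y ∈ Ioo a b, ∀ m : EuclideanSpace ℝ (Fin 3) → EuclideanSpace ℝ (Fin 3), ((ContDiff ℝ (⊤ : ℕ∞) m ∧ VectorCalculus.IsDivFree m ∧
        (∫⁻ x, ‖iteratedFDeriv ℝ 0 m x‖ₑ ^ 2 < ⊤) ∧ (∫⁻ x, ‖iteratedFDeriv ℝ 1 m x‖ₑ ^ 2 < ⊤) ∧
        (∫⁻ x, ‖iteratedFDeriv ℝ 2 m x‖ₑ ^ 2 < ⊤)) ∧ 0 < (∫ x, ‖curl m x‖ ^ 2) ∧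
        (∫ x, ⟪curl m x, fderiv ℝ m x (curl m x)⟫_ℝ) = c * (∫ x, ‖curl m x‖ ^ 2) ^ (3 / 4 : ℝ) *
          (∫ x, frobeniusNormSq (fderiv ℝ (curl m) x)) ^ (3 / 4 : ℝ) ∧
        (∫ x, frobeniusNormSq (fderiv ℝ (curl m) x)) = 81 * c ^ 4 / (256 * ν ^ 4) * (∫ x, ‖curl m x‖ ^ 2) ^ 3) →
        (∫ x, ‖m x‖ ^ 2) * (∫ x, ‖curl m x‖ ^ 2) ≠ y) →
      (∀ m : EuclideanSpace ℝ (Fin 3) → EuclideanSpace ℝ (Fin 3), ((ContDiff ℝ (⊤ : ℕ∞) m ∧ VectorCalculus.IsDivFree m ∧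
        (∫⁻ x, ‖iteratedFDeriv ℝ 0 m x‖ₑ ^ 2 < ⊤) ∧ (∫⁻ x, ‖iteratedFDeriv ℝ 1 m x‖ₑ ^ 2 < ⊤) ∧
        (∫⁻ x, ‖iteratedFDeriv ℝ 2 m x‖ₑ ^ 2 < ⊤)) ∧ 0 < (∫ x, ‖curl m x‖ ^ 2) ∧
        (∫ x, ⟪curl m x, fderiv ℝ m x (curl m x)⟫_ℝ) = c * (∫ x, ‖curl m x‖ ^ 2) ^ (3 / 4 : ℝ) *
          (∫ x, frobeniusNormSq (fderiv ℝ (curl m) x)) ^ (3 / 4 : ℝ) ∧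
        (∫ x, frobeniusNormSq (fderiv ℝ (curl m) x)) = 81 * c ^ 4 / (256 * ν ^ 4) * (∫ x, ‖curl m x‖ ^ 2) ^ 3) →
        (∫ x, ‖m x‖ ^ 2) * (∫ x, ‖curl m x‖ ^ 2) ≠ 256 * ν ^ 4 / (27 * c ^ 4)) →
      ∀ s ∈ Ioo 0 T, s + η * (64 * ν ^ 3 / (27 * c ^ 4) * (∫ x, ‖curl (u s) x‖ ^ 2)⁻¹ ^ 2) < T →
        ∃ θ : ℝ, 0 < θ ∧ (1 - η + 2 * θ) * (∫ x, ‖curl (u s) x‖ ^ 2)⁻¹ ^ 2 ≤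
          (∫ x, ‖curl (u (s + η * (64 * ν ^ 3 / (27 * c ^ 4) * (∫ x, ‖curl (u s) x‖ ^ 2)⁻¹ ^ 2))) x‖ ^ 2)⁻¹ ^ 2 := by
  obtain ⟨c, hsharp, hED⟩ := earlyDeficit_pos_of_nonMaximiser_instant
  obtain ⟨c₄, hsharp₄, h4⟩ := exists_nonMaximiser_instant_of_thin_valueSet
  have hc₄ : c₄ = c := sharp_const_unique hsharp₄ hsharp
  subst hc₄
  obtain ⟨c₁, -, hbud⟩ := exists_budget_saturated_iff_normalisedMaximiser
  refine ⟨c₄, hsharp₄, fun η hη0 hη1 ν T hν hT u p hmax hLH hdec hV hNR s hs hs'T => ?_⟩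
  have hc : 0 < c₄ := hsharp₄.1
  obtain ⟨Zr, D, hZD, -⟩ := hbud ν T hν hT u p hmax hLH hdec
  have hZpos : 0 < ∫ x, ‖curl (u s) x‖ ^ 2 := by
    have h1 := lintegral_curl_sq_pos hν hT hmax hLH hdec s ⟨hs.1.le, hs.2⟩
    rw [(hZD s hs).1] at h1
    rw [← (hZD s hs).2.2.2.1]
    exact ENNReal.ofReal_pos.1 h1
  set W : ℝ := η * (64 * ν ^ 3 / (27 * c₄ ^ 4) * (∫ x, ‖curl (u s) x‖ ^ 2)⁻¹ ^ 2) with hW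
  have hWpos : 0 < W := mul_pos hη0 (mul_pos (by positivity) (pow_pos (inv_pos.2 hZpos) 2))
  obtain ⟨σ, hσ, hnot⟩ := h4 ν T hν hT u p hmax hLH hdec hV hNR s (s + W / 2) hs.1 (by linarith) (by linarith)
  exact hED η hη0 hη1 ν T hν hT u p hmax hLH hdec s hs hs'T σ ⟨hσ.1, by linarith [hσ.2]⟩ hnot

end Resonance

end RigidExit

end Summit.NavierStokesRegularity.NavierStokesRegularity.Theorems

end
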